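import Summits.CriticalPhenomena.PercolationContinuityZ3.Theorems.PercNearOneGluingNoHeavyLowerTailMajorityGluingTypeBridgeMap
import HarnessLib

/-!
# The TYPE BRIDGE, part III: the law of the hub gadget on the 94 types and its linear functionals (lane prim-rate, constants-miner 1, gen 31; CANDIDATES §GEN-18 R154, §GEN-31)

Support file for the closed crux `NoHeavyLowerTail` (stmt-CriticalPhenomena-4575), majority-gluing line.  The SCALE-FREE LAW of the hub gadget
`(a; v 1, …, v 4)` under `prodBernoulli w`: `law w a v M τ = μ(typeOf a v ω = τ)/M` on the deterministic types (part II).  Because `typeOf`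
always lands in the table (`typeOf_mem`) and the table has no duplicates (`nodup_allTypes`), every linear functional of the abstract programme is an
expectation: **`lin φ (law w a v M) = E[φ(typeOf a v ω)]/M`** (`lin_law`), in particular `lin 1_b (law) = μ(b(typeOf ω))/M` for Boolean type
events (`lin_ind_law`) — the masses `uS, Tm, Sm, Cm, Pm, ACm, Rho0, Pim, …` of `SymLaw` are the probabilities of the corresponding configuration
events divided by `M`, and `E(law) = (μ(≥ 3 relays cut) − μ(v 1 cut))/M` (`E_law`).  No sorries. [cite: Grimmett1999, §2.2]
-/

noncomputable section

namespace Summit.CriticalPhenomena.PercolationContinuityZ3.Theorems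

open MeasureTheory Set
open Literature.Probability.LatticeModels (prodBernoulli)
open Literature.Probability.Percolation
open Literature.Probability.Percolation.BHK2006
open DecisionTree (ind ind_of_mem ind_of_not_mem ind_nonneg)
open scoped Classical

namespace HubOnly
namespace TypeTable
namespace Bridge

open Refresh

variable {n : ℕ}

/-- **The scale-free law of the hub gadget on the deterministic types**: `x_τ = μ(typeOf ω = τ)/M`. -/
def law (w : Sym2 (Fin n) → unitInterval) (a : Fin n) (v : ℕ → Fin n) (M : ℝ) : DType → ℝ :=
  fun τ => (prodBernoulli w).real {ω : BondConfig (Fin n) | typeOf a v ω = τ} / M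

/-- The law is non-negative for `M > 0`. -/
theorem law_nonneg (w : Sym2 (Fin n) → unitInterval) (a : Fin n) (v : ℕ → Fin n) {M : ℝ} (hM : 0 < M) :
    ∀ τ, 0 ≤ law w a v M τ := fun _ => div_nonneg measureReal_nonneg hM.le

/-- **Expectations of type functionals as sums over the table**: `E[φ(typeOf ω)] = Σ_{τ ∈ allTypes} φ(τ)·μ(typeOf ω = τ)`. -/
theorem integral_typeOf (w : Sym2 (Fin n) → unitInterval) (a : Fin n) (v : ℕ → Fin n) (hv : ∀ x ∈ [1, 2, 3, 4], v x ≠ a)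
    (φ : DType → ℤ) :
    ∫ ω, (φ (typeOf a v ω) : ℝ) ∂(prodBernoulli w) =
      (allTypes.map fun τ => (φ τ : ℝ) * (prodBernoulli w).real {ω : BondConfig (Fin n) | typeOf a v ω = τ}).sum := by
  rw [← List.sum_toFinset _ nodup_allTypes, integral_prodBernoulli_eq_sum]
  have hpt : ∀ ω : BondConfig (Fin n), (φ (typeOf a v ω) : ℝ) =
      ∑ τ ∈ allTypes.toFinset, (if typeOf a v ω = τ then (φ τ : ℝ) else 0) := by
    intro ω
    rw [Finset.sum_ite_eq allTypes.toFinset (typeOf a v ω) (fun τ => (φ τ : ℝ)),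
      if_pos (List.mem_toFinset.2 (typeOf_mem a v hv ω))]
  simp_rw [hpt, Finset.mul_sum]
  rw [Finset.sum_comm]
  refine Finset.sum_congr rfl fun τ _ => ?_
  rw [PocketBHK.real_eq_sum_weight_ind, Finset.mul_sum]
  refine Finset.sum_congr rfl fun ω _ => ?_
  by_cases h : typeOf a v ω = τ
  · rw [if_pos h, ind_of_mem (show ω ∈ {ω : BondConfig (Fin n) | typeOf a v ω = τ} from h)]; ring
  · rw [if_neg h, ind_of_not_mem (show ω ∉ {ω : BondConfig (Fin n) | typeOf a v ω = τ} from h)]; ring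

/-- **Linear functionals of the law are expectations**: `lin φ (law) = E[φ(typeOf ω)]/M`. -/
theorem lin_law (w : Sym2 (Fin n) → unitInterval) (a : Fin n) (v : ℕ → Fin n) (hv : ∀ x ∈ [1, 2, 3, 4], v x ≠ a) (M : ℝ)
    (φ : DType → ℤ) :
    lin φ (law w a v M) = (∫ ω, (φ (typeOf a v ω) : ℝ) ∂(prodBernoulli w)) / M := by
  rw [integral_typeOf w a v hv, lin, div_eq_mul_inv, ← List.sum_map_mul_right]
  refine congrArg List.sum (List.map_congr_left fun τ _ => ?_)
  simp only [law]
  ring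

/-- The integral of a Boolean type event is its probability. -/
theorem integral_ind_typeOf (w : Sym2 (Fin n) → unitInterval) (a : Fin n) (v : ℕ → Fin n) (b : DType → Bool) :
    ∫ ω, (DType.ind (b (typeOf a v ω)) : ℝ) ∂(prodBernoulli w) =
      (prodBernoulli w).real {ω : BondConfig (Fin n) | b (typeOf a v ω) = true} := by
  rw [← integral_indicator_one (MeasurableSet.of_discrete :
    MeasurableSet {ω : BondConfig (Fin n) | b (typeOf a v ω) = true})]
  refine integral_congr_ae (Filter.Eventually.of_forall fun ω => ?_)
  by_cases h : b (typeOf a v ω) = true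
  · rw [Set.indicator_of_mem (show ω ∈ {ω : BondConfig (Fin n) | b (typeOf a v ω) = true} from h)]
    simp [DType.ind, h]
  · rw [Set.indicator_of_notMem (show ω ∉ {ω : BondConfig (Fin n) | b (typeOf a v ω) = true} from h)]
    simp [DType.ind, h]

/-- **Boolean type events**: `lin 1_b (law) = μ(b(typeOf ω))/M`. -/
theorem lin_ind_law (w : Sym2 (Fin n) → unitInterval) (a : Fin n) (v : ℕ → Fin n) (hv : ∀ x ∈ [1, 2, 3, 4], v x ≠ a) (M : ℝ)
    (b : DType → Bool) :
    lin (fun τ => DType.ind (b τ)) (law w a v M) = (prodBernoulli w).real {ω : BondConfig (Fin n) | b (typeOf a v ω) = true} / M := by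
  rw [lin_law w a v hv, integral_ind_typeOf]

/-- **The objective**: `E(law) = (μ(at least three relays cut) − μ(v 1 cut))/M` (`e = f − cut₁`). -/
theorem E_law (w : Sym2 (Fin n) → unitInterval) (a : Fin n) (v : ℕ → Fin n) (hv : ∀ x ∈ [1, 2, 3, 4], v x ≠ a) (M : ℝ) :
    E (law w a v M) = ((prodBernoulli w).real {ω : BondConfig (Fin n) | decide (3 ≤ (typeOf a v ω).ncut) = true} -
      (prodBernoulli w).real {ω : BondConfig (Fin n) | (typeOf a v ω).cut 1 = true}) / M := by
  have h3 := integral_ind_typeOf w a v (fun τ => decide (3 ≤ τ.ncut))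
  have h1 := integral_ind_typeOf w a v (fun τ => τ.cut 1)
  rw [E, lin_law w a v hv, ← h3, ← h1, ← integral_sub Integrable.of_finite Integrable.of_finite]
  congr 1
  refine integral_congr_ae (Filter.Eventually.of_forall fun ω => ?_)
  simp only [DType.eZ, DType.fZ, DType.cutZ, Int.cast_sub]

end Bridge
end TypeTable
end HubOnly
end Summit.CriticalPhenomena.PercolationContinuityZ3.Theorems
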